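import Summits.QuantumAdvantage.AdviceFreeQNC0.AffBells29Shadow

/-!
# Frame-shadow reduction — part 2/3: §S.4 cut points (regime I without laws), §S.5 `polyLoss_of_hWide`, §S.6 the transfer principle and `HAbs`

VERBATIM split (400-line rule) of planner qa-qnc0-p1 g29's `HOME/qa-qnc0-p1/exp29/Shadow29.lean` (sha16 `0a7e49ebba69860e`, 872 lines, farm
rc 0 / 0 sorry / 0 warnings, axioms standard; authored AND proved by the planner seat; landed by qn-prover-3 g15, ask P-29h) into
`AffBells29Shadow.lean` (§S.1–§S.3), `AffBells29Transfer.lean` (§S.4–§S.6), `AffBells29Shape.lean` (§S.7); only the file boundaries, the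
per-file preambles, these header lines and one-line docstrings on undocumented auxiliaries are new.  The planner's module docstring follows.

# Sketch29 / Shadow29 (planner qn-p1 g29, ROUND-28 rev. 3 §6(b)(S3′)(ii), ask P-29h): the FRAME-SHADOW REDUCTION — typed and PROVED

The pure regime (`HPure`, regime II of ROUND-28 §6) reduces to ONE conjecture about WIDE rows.  Fix a width `w`
(think `w = C·log₂ N`).  A row `b` of the affine strategy `(β, c)` is WIDE if `|supp β_b| > w`, NARROW otherwise.  The
`w`-SHADOW `(shadowRow w β, shadowOff w β c)` keeps every narrow row and replaces every wide row by the zero row with offset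
`0` — a bell that ALWAYS fires.  Two facts, both PROVED here:

* `shadow_pointwise` / `shadow_count` (bookkeeping on `targetFormula`): at an odd point `x` where the WIDE ACTIVE rows fire with
  parity `≡` their number (`WideParityAt w β c x`), the strategy and its shadow win or lose TOGETHER; hence
  `affWinCard β c ≤ affWinCard (shadow) + #{x odd : ¬ WideParityAt w β c x}`.
* `juntaLogHard` / `shadow_loses` (from the TREE theorem `AffBells23.ringHardOddCond2`, δ₀ = 0, degree exponent 2): a strategy
  whose every output bit reads `≤ C·log₂ N` input bits wins on at most `θ·2^{N−1}` odd inputs, ONE absolute `θ < 1` for all `C`;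
  the `w`-shadow with `w ≤ C log₂ N` is such a strategy (`readsOnly_shadow`).

Consequently (`shadow_bound`): `affWinCard β c ≤ θ·2^{N−1} + #{x odd : ¬ WideParityAt w β c x}` for EVERY `(β, c)` and every
`w ≤ C log₂ N`, `N ≥ n₀(C)`.  The remaining conjecture of the (NP₁) programme is therefore the typed statement `HWide` below
(«far from frames ∧ few pair-cut points ⇒ wide parity fails on an o(1) fraction of the odd class»), and the WHOLE glue is PROVED here
without window laws: `polyLoss_of_hWide : HWide → AffBellsPolyLoss3` (§S.5) — frames by the tree's `AffBells27.affFrameLoss`, regime I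
(many cut points) by the elementary double count `cutPoints_le` (§S.4: a cut point is a loser or one pair flip from one), regime II by
`HWide` + `shadow_bound`.  §S.6 adds the general TRANSFER PRINCIPLE (`transfer_pointwise/count/bound`, `degHard`: the ring relation sees a strategy only through
the parity of its ACTIVE answer bits, so ANY polylog-degree strategy agreeing with `(β, c)` in active parity a.e. bounds `affWinCard`) and the weaker
conjecture `HAbs` with `hAbs_of_hWide : HWide → HAbs` and `polyLoss_of_hAbs : HAbs → AffBellsPolyLoss3` (PROVED).
Why `HWide` should hold (ROUND-28 §6(b) T1–T5, §6A): balanced proportionality classes fire `≡ |class|`; the free-phase lemma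
(`AffBells29.freePhase_parity`, Expansion29), the subspace / Fourier / ANF-tower lemmas and the single-deletion argument say
window-purity forces the wide classes to be balanced except on near-twin clusters, which far-ness and activity variation kill;
wide rows blind or 1-thin on the coins of `x` are `N^{1−cC}`-rare.

WHAT THIS IS NOT: no claim about the crux `RingDenseResidualLt3`; `HWide` is a conjecture (typed, unproved); separation NOT moved.
-/

noncomputable section

open Classical

namespace Summit.QuantumAdvantage.AdviceFreeQNC0

namespace AffBells29

open Finset Literature.Computability.QuantumComplexity Literature.Computability.QuantumComplexity.RingHLF
open Literature.Computability.MetaComplexity Literature.Computability.MetaComplexity.Smolensky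
open AffBells23 AffBells26 Fib19 AffBells27 AffBells28

variable {N : ℕ}


/-! ### §S.4 Regime I without laws: the cut-point double count (PROVED) -/

/-- The odd inputs on which `(β, c)` LOSES. -/
def losers (β : Fin N → Fin N → ZMod 3) (c : Fin N → ZMod 3) : Finset (Fin N → Bool) :=
  univ.filter fun x => IsOdd x ∧ ¬ RingHLF.Rel x (affBell β c x)

/-- Wins + losses = the odd class, `2^{N−1}`. -/
theorem affWinCard_add_losers (hN : 1 ≤ N) (β : Fin N → Fin N → ZMod 3) (c : Fin N → ZMod 3) :
    affWinCard β c + (losers β c).card = 2 ^ (N - 1) := by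
  have hA : affWinCard β c = ((univ.filter fun x : Fin N → Bool => IsOdd x).filter fun x => RingHLF.Rel x (affBell β c x)).card := by
    unfold affWinCard
    congr 1
    ext x
    simp only [mem_filter, mem_univ, true_and, isOdd_iff_oddZeros]
  have hB : losers β c = ((univ.filter fun x : Fin N → Bool => IsOdd x).filter fun x => ¬ RingHLF.Rel x (affBell β c x)) := by
    ext x
    simp only [losers, mem_filter, mem_univ, true_and]
  rw [hA, hB, card_filter_add_card_filter_not, card_isOdd hN]

/-- **CUT-POINT DOUBLE COUNT (PROVED):** every cut point is a loser or one coin-pair flip away from a loser, so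
`#cutPoints ≤ (N² + 1)·#losers`. -/
theorem cutPoints_le (hN : 3 ≤ N) (β : Fin N → Fin N → ZMod 3) (c : Fin N → ZMod 3) :
    (cutPoints β c).card ≤ (N ^ 2 + 1) * (losers β c).card := by
  have hsub : cutPoints β c ⊆ losers β c ∪ (losers β c).biUnion fun y =>
      ((univ : Finset (Fin N)) ×ˢ (univ : Finset (Fin N))).image fun p => flipAt y ({p.1, p.2} : Finset (Fin N)) := by
    intro x hx
    rw [cutPoints, mem_filter] at hx
    obtain ⟨_, hodd, i, hi, j, hj, hij, hne⟩ := hx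
    rw [mem_union]
    by_cases hR : RingHLF.Rel x (affBell β c x)
    · right
      have hi' : kline x i = false := by rw [klineZeros, mem_filter] at hi; exact hi.2
      have hj' : kline x j = false := by rw [klineZeros, mem_filter] at hj; exact hj.2
      have hodd' : IsOdd (flipAt x {i, j}) := (kline_flipPair hN x hodd hij hi' hj').1
      have hlose : ¬ RingHLF.Rel (flipAt x {i, j}) (affBell β c (flipAt x {i, j})) := fun h => hne ⟨fun _ => h, fun _ => hR⟩
      rw [mem_biUnion]
      refine ⟨flipAt x {i, j}, ?_, ?_⟩
      · rw [losers, mem_filter]; exact ⟨mem_univ _, hodd', hlose⟩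
      · rw [mem_image]
        exact ⟨(i, j), by simp, flipAt_flipAt x {i, j}⟩
    · left
      rw [losers, mem_filter]; exact ⟨mem_univ _, hodd, hR⟩
  refine le_trans (card_le_card hsub) (le_trans (card_union_le _ _) ?_)
  have hb : ((losers β c).biUnion fun y =>
      ((univ : Finset (Fin N)) ×ˢ (univ : Finset (Fin N))).image fun p => flipAt y ({p.1, p.2} : Finset (Fin N))).card
      ≤ (losers β c).card * N ^ 2 := by
    refine le_trans card_biUnion_le ?_
    rw [← smul_eq_mul, ← sum_const]
    refine sum_le_sum fun y _ => le_trans card_image_le ?_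
    rw [card_product, card_univ, Fintype.card_fin, sq]
  nlinarith [hb]

/-! ### §S.5 Assembly: `HWide → AffBellsPolyLoss3` (PROVED; frames by `AffBells27.affFrameLoss`, regime I by §S.4, regime II by §S.2–3) -/

/-- **(NP₁) from `HWide` (PROVED).**  `ε := (1 − θ)/4` with `θ` the shadow constant; `e = a(ε) + 3`. -/
theorem polyLoss_of_hWide (h : HWide) : AffBellsPolyLoss3 := by
  obtain ⟨δ₀, hδ₀, r₀, w₀, hW⟩ := h
  obtain ⟨θ, hθ, hall⟩ := shadow_bound
  have hε : (0 : ℝ) < (1 - θ) / 4 := by linarith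
  obtain ⟨C, a, n₀, hW⟩ := hW ((1 - θ) / 4) hε
  obtain ⟨n₁, hn₁⟩ := hall C
  obtain ⟨θF, hθF, nF, hnF⟩ := affFrameLoss δ₀ hδ₀ r₀ w₀
  obtain ⟨M, hM⟩ := exists_nat_gt (4 / (1 - θ))
  obtain ⟨MF, hMF⟩ := exists_nat_gt (2 / (1 - θF))
  refine ⟨a + 3, max (max (max n₀ n₁) (max nF 3)) (max M MF), fun N hN β c => ?_⟩
  have hN₀ : n₀ ≤ N := le_trans (le_trans (le_trans (le_max_left _ _) (le_max_left _ _)) (le_max_left _ _)) hN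
  have hN₁ : n₁ ≤ N := le_trans (le_trans (le_trans (le_max_right _ _) (le_max_left _ _)) (le_max_left _ _)) hN
  have hNF : nF ≤ N := le_trans (le_trans (le_trans (le_max_left _ _) (le_max_right _ _)) (le_max_left _ _)) hN
  have h3 : 3 ≤ N := le_trans (le_trans (le_trans (le_max_right _ _) (le_max_right _ _)) (le_max_left _ _)) hN
  have hNM : M ≤ N := le_trans (le_trans (le_max_left _ _) (le_max_right _ _)) hN
  have hNMF : MF ≤ N := le_trans (le_trans (le_max_right _ _) (le_max_right _ _)) hN
  have hNpos : (0 : ℝ) < N := by exact_mod_cast (show 0 < N by omega)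
  have hN1 : (1 : ℝ) ≤ N := by exact_mod_cast (show 1 ≤ N by omega)
  have h2pow : (0 : ℝ) < (2 : ℝ) ^ (N - 1) := by positivity
  have hpowN : (N : ℝ) ≤ (N : ℝ) ^ (a + 3) := by
    calc (N : ℝ) = (N : ℝ) ^ 1 := (pow_one _).symm
      _ ≤ (N : ℝ) ^ (a + 3) := pow_le_pow_right₀ hN1 (by omega)
  have hinv : 1 / (N : ℝ) ^ (a + 3) ≤ 1 / (N : ℝ) := one_div_le_one_div_of_le hNpos hpowN
  have hinvpos : (0 : ℝ) ≤ 1 / (N : ℝ) ^ (a + 3) := by positivity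
  -- `1/N ≤ (1-θ)/4` and `1/N ≤ (1-θF)/2`
  have hNθ : 1 / (N : ℝ) ≤ (1 - θ) / 4 := by
    have h1t : 0 < 1 - θ := by linarith
    have hNt : 4 / (1 - θ) < (N : ℝ) := lt_of_lt_of_le hM (by exact_mod_cast hNM)
    rw [div_le_iff₀ hNpos]
    have := (div_lt_iff₀ h1t).1 hNt
    linarith
  have hNθF : 1 / (N : ℝ) ≤ (1 - θF) / 2 := by
    have h1t : 0 < 1 - θF := by linarith
    have hNt : 2 / (1 - θF) < (N : ℝ) := lt_of_lt_of_le hMF (by exact_mod_cast hNMF)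
    rw [div_le_iff₀ hNpos]
    have := (div_lt_iff₀ h1t).1 hNt
    linarith
  have hgoal : ∀ t : ℝ, t + 1 / (N : ℝ) ^ (a + 3) ≤ 1 → (affWinCard β c : ℝ) ≤ t * (2 : ℝ) ^ (N - 1) →
      (affWinCard β c : ℝ) ≤ (1 - 1 / (N : ℝ) ^ (a + 3)) * (2 : ℝ) ^ (N - 1) := by
    intro t ht hle
    exact hle.trans (mul_le_mul_of_nonneg_right (by linarith) h2pow.le)
  by_cases hfr : FrameDecomp δ₀ r₀ w₀ β
  · -- frames
    exact hgoal θF (by linarith) (hnF N hNF β c hfr)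
  · by_cases hcut : ((cutPoints β c).card : ℝ) ≤ (2 : ℝ) ^ (N - 1) / (N : ℝ) ^ a
    · -- regime II: HWide + shadow
      have h1 := hn₁ N hN₁ h3 β c (C * Nat.log 2 N) le_rfl
      have h2 := hW N hN₀ β c hfr hcut
      refine hgoal (θ + (1 - θ) / 4) (by linarith) ?_
      rw [add_mul]
      linarith
    · -- regime I: many cut points ⇒ many losers
      have hcutN : (2 : ℝ) ^ (N - 1) / (N : ℝ) ^ a < (cutPoints β c).card := lt_of_not_ge hcut
      have hdc : ((cutPoints β c).card : ℝ) ≤ ((N : ℝ) ^ 2 + 1) * (losers β c).card := by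
        exact_mod_cast cutPoints_le h3 β c
      have hsum : (affWinCard β c : ℝ) + (losers β c).card = (2 : ℝ) ^ (N - 1) := by
        exact_mod_cast affWinCard_add_losers (by omega) β c
      have hN2 : (2 : ℝ) ≤ N := by exact_mod_cast (show 2 ≤ N by omega)
      have hcube : (N : ℝ) ^ 2 + 1 ≤ (N : ℝ) ^ 3 := by nlinarith
      have hNa : (0 : ℝ) < (N : ℝ) ^ a := by positivity
      have hlos : (2 : ℝ) ^ (N - 1) / (N : ℝ) ^ (a + 3) ≤ (losers β c).card := by
        have h1 : (2 : ℝ) ^ (N - 1) < (N : ℝ) ^ a * (((N : ℝ) ^ 2 + 1) * (losers β c).card) := by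
          have := (div_lt_iff₀' hNa).1 hcutN
          nlinarith
        have h2 : (N : ℝ) ^ a * (((N : ℝ) ^ 2 + 1) * (losers β c).card) ≤ (N : ℝ) ^ (a + 3) * (losers β c).card := by
          rw [pow_add, mul_assoc]
          refine mul_le_mul_of_nonneg_left (mul_le_mul_of_nonneg_right hcube (by positivity)) hNa.le
        rw [div_le_iff₀' (by positivity)]
        linarith
      have hdiv : (1 - 1 / (N : ℝ) ^ (a + 3)) * (2 : ℝ) ^ (N - 1) = (2 : ℝ) ^ (N - 1) - (2 : ℝ) ^ (N - 1) / (N : ℝ) ^ (a + 3) := by ring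
      rw [hdiv]
      linarith

/-! ### §S.6 The general TRANSFER PRINCIPLE and the weaker conjecture `HAbs` (PROVED reductions)

By `targetFormula` the ring relation sees a strategy only through the PARITY OF ITS ACTIVE ANSWER BITS.  Hence ANY strategy `z'` whose bits are
polylog-degree `𝔽₂`-polynomials and which agrees with `affBell β c` in active parity outside a set `B` gives `affWinCard β c ≤ θ·2^{N−1} + |B|`
(`ringHardOddCond2`, `δ₀ = 0`, degree `(log₂ N)^C`).  The shadow is the special case `z' = affBell (shadow)`.  The weakest conjecture of this shape is
`HAbs` («an a.e.-pure far affine strategy has, a.e., the active parity of SOME polylog-degree strategy»); `HWide → HAbs → AffBellsPolyLoss3`. -/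

/-- active parity of a general strategy `z'` agrees with that of `affBell β c` at `x`. -/
def ActParityAgree (β : Fin N → Fin N → ZMod 3) (c : Fin N → ZMod 3) (z' : (Fin N → Bool) → Fin N → Bool) (x : Fin N → Bool) : Prop :=
  activeOnes x (z' x) % 2 = activeOnes x (affBell β c x) % 2

/-- **TRANSFER, POINTWISE (PROVED):** equal active parity ⇒ win together. -/
theorem transfer_pointwise (hN : 3 ≤ N) (β : Fin N → Fin N → ZMod 3) (c : Fin N → ZMod 3) (z' : (Fin N → Bool) → Fin N → Bool)
    {x : Fin N → Bool} (hx : IsOdd x) (h : ActParityAgree β c z' x) :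
    RingHLF.Rel x (affBell β c x) ↔ RingHLF.Rel x (z' x) := by
  have h1 := targetFormula N hN x hx (affBell β c x)
  have h2 := targetFormula N hN x hx (z' x)
  unfold ActParityAgree at h
  rw [h1, h2]
  constructor <;> intro hh <;> omega

/-- **TRANSFER COUNT (PROVED).** -/
theorem transfer_count (hN : 3 ≤ N) (β : Fin N → Fin N → ZMod 3) (c : Fin N → ZMod 3) (z' : (Fin N → Bool) → Fin N → Bool) :
    affWinCard β c ≤ AffBells22.winCount z'
      + (univ.filter fun x : Fin N → Bool => IsOdd x ∧ ¬ ActParityAgree β c z' x).card := by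
  unfold affWinCard AffBells22.winCount
  refine le_trans (card_le_card ?_) (card_union_le _ _)
  intro x hx
  rw [mem_filter] at hx
  rw [mem_union, mem_filter, mem_filter]
  have hodd : IsOdd x := (isOdd_iff_oddZeros x).2 hx.2.1
  by_cases hA : ActParityAgree β c z' x
  · exact Or.inl ⟨mem_univ _, hx.2.1, (transfer_pointwise hN β c z' hodd hA).1 hx.2.2⟩
  · exact Or.inr ⟨mem_univ _, hodd, hA⟩

/-- the `𝔽₂`-indicator polynomial of an answer bit. -/
def bitFn (z' : (Fin N → Bool) → Fin N → Bool) (k : Fin N) : CubeFn (ZMod 2) N := fun x => if z' x k then 1 else 0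

/-- **POLYLOG-DEGREE STRATEGIES LOSE (PROVED, = `ringHardOddCond2` at `δ₀ = 0`):** one absolute `θ < 1`; for every `C`, `N ≥ n₀(C)`, every
strategy all of whose answer bits have `𝔽₂`-degree `≤ (log₂ N)^C` wins on at most `θ·2^{N−1}` odd inputs. -/
theorem degHard : ∃ θ : ℝ, θ < 1 ∧ ∀ C : ℕ, ∃ n₀ : ℕ, ∀ N ≥ n₀, ∀ z' : (Fin N → Bool) → Fin N → Bool,
    (∀ k, bitFn z' k ∈ lowDeg (ZMod 2) N ((Nat.log 2 N) ^ C)) → (AffBells22.winCount z' : ℝ) ≤ θ * (2 : ℝ) ^ (N - 1) := by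
  obtain ⟨θ, hθ, hall⟩ := ringHardOddCond2 (δ₀ := 0) (by norm_num)
  refine ⟨θ, hθ, fun C => ?_⟩
  obtain ⟨n₀, hn₀⟩ := hall C
  refine ⟨n₀, fun N hN z' hdegz => ?_⟩
  have hdeg : ∀ (a : Fin N → Bool) (k : Fin N),
      (fun x => bitFn z' k (AffBells22.subcubeMerge ∅ a x)) ∈ lowDeg (ZMod 2) N ((Nat.log 2 N) ^ C) := by
    intro a k
    have hfun : (fun x => bitFn z' k (AffBells22.subcubeMerge ∅ a x)) = bitFn z' k := by
      funext x; rw [subcubeMerge_empty]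
    rw [hfun]
    exact hdegz k
  have hW : ((∅ : Finset (Fin N)).card : ℝ) ≤ 0 * N := by simp
  have h := hn₀ N hN ∅ (bitFn z') hW hdeg
  have hfun : ∀ x : Fin N → Bool, (fun i => decide (bitFn z' i x = 1)) = z' x := by
    intro x
    funext k
    simp only [bitFn]
    by_cases hgk : z' x k = true
    · simp [hgk]
    · simp [hgk]
  have hset : ((univ : Finset (Fin N → Bool)).filter fun x => OddZeros x ∧ Rel x (z' x))
      = (univ : Finset (Fin N → Bool)).filter fun x => OddZeros x ∧ Rel x (fun i => decide (bitFn z' i x = 1)) := by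
    ext x
    simp only [mem_filter, hfun x]
  unfold AffBells22.winCount
  rw [hset]
  exact h

/-- **TRANSFER BOUND (PROVED):** `affWinCard β c ≤ θ·2^{N−1} + #{x odd : active parity of z' ≠ that of (β, c)}` for every polylog-degree `z'`. -/
theorem transfer_bound : ∃ θ : ℝ, θ < 1 ∧ ∀ C : ℕ, ∃ n₀ : ℕ, ∀ N ≥ n₀, 3 ≤ N → ∀ (β : Fin N → Fin N → ZMod 3) (c : Fin N → ZMod 3)
    (z' : (Fin N → Bool) → Fin N → Bool), (∀ k, bitFn z' k ∈ lowDeg (ZMod 2) N ((Nat.log 2 N) ^ C)) →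
      (affWinCard β c : ℝ) ≤ θ * (2 : ℝ) ^ (N - 1) + ((univ.filter fun x : Fin N → Bool => IsOdd x ∧ ¬ ActParityAgree β c z' x).card : ℝ) := by
  obtain ⟨θ, hθ, hall⟩ := degHard
  refine ⟨θ, hθ, fun C => ?_⟩
  obtain ⟨n₀, hn₀⟩ := hall C
  refine ⟨n₀, fun N hN h3 β c z' hz => ?_⟩
  have h1 := transfer_count h3 β c z'
  have h2 := hn₀ N hN z' hz
  calc (affWinCard β c : ℝ) ≤ (AffBells22.winCount z' : ℝ)
        + ((univ.filter fun x : Fin N → Bool => IsOdd x ∧ ¬ ActParityAgree β c z' x).card : ℝ) := by exact_mod_cast h1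
    _ ≤ _ := by linarith

/-- **`HAbs`** («absorbable defect») — WEAKER than `HWide`: a far affine strategy with few cut points has, outside an `ε`-fraction of the odd class,
the ACTIVE PARITY of some strategy whose answer bits are `𝔽₂`-polynomials of degree `≤ (log₂ N)^C`.  (`HWide` gives it with `z'` = the shadow;
bounded exotic clusters should be absorbable too — ROUND-28 §6A T6.)  Why it might fail: the fibre-parity function of an a.e.-pure far strategy could
be a.e. NON-realisable by polylog-degree strategies only if it a.e. equals the winning parity `N + zeros J + pairs2 J` up to a realisable one —
i.e. only if (NP₁) itself fails in that regime, or if realisability is the wrong dichotomy; no candidate known. -/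
def HAbs : Prop :=
  ∃ δ₀ : ℝ, δ₀ < 1 / 2 ∧ ∃ r₀ w₀ : ℕ, ∀ ε : ℝ, 0 < ε → ∃ C a n₀ : ℕ, ∀ N ≥ n₀, ∀ (β : Fin N → Fin N → ZMod 3) (c : Fin N → ZMod 3),
    ¬ FrameDecomp δ₀ r₀ w₀ β →
    ((cutPoints β c).card : ℝ) ≤ (2 : ℝ) ^ (N - 1) / (N : ℝ) ^ a →
      ∃ z' : (Fin N → Bool) → Fin N → Bool, (∀ k, bitFn z' k ∈ lowDeg (ZMod 2) N ((Nat.log 2 N) ^ C)) ∧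
        (((univ.filter fun x : Fin N → Bool => IsOdd x ∧ ¬ ActParityAgree β c z' x).card : ℝ) ≤ ε * (2 : ℝ) ^ (N - 1))

/-- Wide parity ⇒ the shadow agrees in active parity. -/
theorem actParityAgree_shadow (w : ℕ) (β : Fin N → Fin N → ZMod 3) (c : Fin N → ZMod 3) {x : Fin N → Bool}
    (h : WideParityAt w β c x) : ActParityAgree β c (fun x => affBell (shadowRow w β) (shadowOff w β c) x) x := by
  unfold ActParityAgree
  rw [activeOnes_affBell β c rfl, activeOnes_affBell (shadowRow w β) (shadowOff w β c) rfl]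
  have hs1 := fires_split β c (act x) x (fun g => w < (rowSupp β g).card)
  have hs2 := fires_split (shadowRow w β) (shadowOff w β c) (act x) x (fun g => w < (rowSupp β g).card)
  have hw := fires_shadow_wide w β c x
  have hn := fires_shadow_narrow w β c x
  unfold WideParityAt at h
  unfold wideAct at h hw
  rw [hs1, hs2, hw, hn]
  omega

/-- The shadow's bits have degree `≤ w ≤ C·log₂ N ≤ (log₂ N)^2` (`N ≥ 2^C`). -/
theorem bitFn_shadow_lowDeg (C w : ℕ) (hN : 2 ^ C ≤ N) (hw : w ≤ C * Nat.log 2 N) (β : Fin N → Fin N → ZMod 3) (c : Fin N → ZMod 3)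
    (k : Fin N) : bitFn (fun x => affBell (shadowRow w β) (shadowOff w β c) x) k ∈ lowDeg (ZMod 2) N ((Nat.log 2 N) ^ 2) := by
  have hlog : C ≤ Nat.log 2 N := Nat.le_log_of_pow_le (by norm_num) hN
  have hdegle : C * Nat.log 2 N ≤ (Nat.log 2 N) ^ 2 := by
    rw [sq]; exact Nat.mul_le_mul_right _ hlog
  exact lowDeg_mono (le_trans (le_trans (card_shadowReads_le w β k) hw) hdegle)
    (AffBells22.indicator_mem_lowDeg (shadowReads w β k) _ (readsOnly_shadow w β c k))

/-- **`HWide → HAbs` (PROVED):** take `z'` = the `(C·log₂ N)`-shadow. -/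
theorem hAbs_of_hWide (h : HWide) : HAbs := by
  obtain ⟨δ₀, hδ₀, r₀, w₀, hW⟩ := h
  refine ⟨δ₀, hδ₀, r₀, w₀, fun ε hε => ?_⟩
  obtain ⟨C, a, n₀, hW⟩ := hW ε hε
  refine ⟨2, a, max n₀ (2 ^ C), fun N hN β c hfr hcut => ?_⟩
  have hN₀ : n₀ ≤ N := le_trans (le_max_left _ _) hN
  have hNC : 2 ^ C ≤ N := le_trans (le_max_right _ _) hN
  refine ⟨fun x => affBell (shadowRow (C * Nat.log 2 N) β) (shadowOff (C * Nat.log 2 N) β c) x,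
    fun k => bitFn_shadow_lowDeg C _ hNC le_rfl β c k, ?_⟩
  refine le_trans ?_ (hW N hN₀ β c hfr hcut)
  exact_mod_cast card_le_card fun x hx => by
    rw [mem_filter] at hx ⊢
    exact ⟨hx.1, hx.2.1, fun hWP => hx.2.2 (actParityAgree_shadow _ β c hWP)⟩

/-- **(NP₁) from `HAbs` (PROVED)** — same assembly as `polyLoss_of_hWide` with `transfer_bound` in place of `shadow_bound`. -/
theorem polyLoss_of_hAbs (h : HAbs) : AffBellsPolyLoss3 := by
  obtain ⟨δ₀, hδ₀, r₀, w₀, hW⟩ := h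
  obtain ⟨θ, hθ, hall⟩ := transfer_bound
  have hε : (0 : ℝ) < (1 - θ) / 4 := by linarith
  obtain ⟨C, a, n₀, hW⟩ := hW ((1 - θ) / 4) hε
  obtain ⟨n₁, hn₁⟩ := hall C
  obtain ⟨θF, hθF, nF, hnF⟩ := affFrameLoss δ₀ hδ₀ r₀ w₀
  obtain ⟨M, hM⟩ := exists_nat_gt (4 / (1 - θ))
  obtain ⟨MF, hMF⟩ := exists_nat_gt (2 / (1 - θF))
  refine ⟨a + 3, max (max (max n₀ n₁) (max nF 3)) (max M MF), fun N hN β c => ?_⟩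
  have hN₀ : n₀ ≤ N := le_trans (le_trans (le_trans (le_max_left _ _) (le_max_left _ _)) (le_max_left _ _)) hN
  have hN₁ : n₁ ≤ N := le_trans (le_trans (le_trans (le_max_right _ _) (le_max_left _ _)) (le_max_left _ _)) hN
  have hNF : nF ≤ N := le_trans (le_trans (le_trans (le_max_left _ _) (le_max_right _ _)) (le_max_left _ _)) hN
  have h3 : 3 ≤ N := le_trans (le_trans (le_trans (le_max_right _ _) (le_max_right _ _)) (le_max_left _ _)) hN
  have hNM : M ≤ N := le_trans (le_trans (le_max_left _ _) (le_max_right _ _)) hN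
  have hNMF : MF ≤ N := le_trans (le_trans (le_max_right _ _) (le_max_right _ _)) hN
  have hNpos : (0 : ℝ) < N := by exact_mod_cast (show 0 < N by omega)
  have hN1 : (1 : ℝ) ≤ N := by exact_mod_cast (show 1 ≤ N by omega)
  have h2pow : (0 : ℝ) < (2 : ℝ) ^ (N - 1) := by positivity
  have hpowN : (N : ℝ) ≤ (N : ℝ) ^ (a + 3) := by
    calc (N : ℝ) = (N : ℝ) ^ 1 := (pow_one _).symm
      _ ≤ (N : ℝ) ^ (a + 3) := pow_le_pow_right₀ hN1 (by omega)
  have hinv : 1 / (N : ℝ) ^ (a + 3) ≤ 1 / (N : ℝ) := one_div_le_one_div_of_le hNpos hpowN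
  have hinvpos : (0 : ℝ) ≤ 1 / (N : ℝ) ^ (a + 3) := by positivity
  have hNθ : 1 / (N : ℝ) ≤ (1 - θ) / 4 := by
    have h1t : 0 < 1 - θ := by linarith
    have hNt : 4 / (1 - θ) < (N : ℝ) := lt_of_lt_of_le hM (by exact_mod_cast hNM)
    rw [div_le_iff₀ hNpos]
    have := (div_lt_iff₀ h1t).1 hNt
    linarith
  have hNθF : 1 / (N : ℝ) ≤ (1 - θF) / 2 := by
    have h1t : 0 < 1 - θF := by linarith
    have hNt : 2 / (1 - θF) < (N : ℝ) := lt_of_lt_of_le hMF (by exact_mod_cast hNMF)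
    rw [div_le_iff₀ hNpos]
    have := (div_lt_iff₀ h1t).1 hNt
    linarith
  have hgoal : ∀ t : ℝ, t + 1 / (N : ℝ) ^ (a + 3) ≤ 1 → (affWinCard β c : ℝ) ≤ t * (2 : ℝ) ^ (N - 1) →
      (affWinCard β c : ℝ) ≤ (1 - 1 / (N : ℝ) ^ (a + 3)) * (2 : ℝ) ^ (N - 1) := by
    intro t ht hle
    exact hle.trans (mul_le_mul_of_nonneg_right (by linarith) h2pow.le)
  by_cases hfr : FrameDecomp δ₀ r₀ w₀ β
  · exact hgoal θF (by linarith) (hnF N hNF β c hfr)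
  · by_cases hcut : ((cutPoints β c).card : ℝ) ≤ (2 : ℝ) ^ (N - 1) / (N : ℝ) ^ a
    · obtain ⟨z', hz', hbad⟩ := hW N hN₀ β c hfr hcut
      have h1 := hn₁ N hN₁ h3 β c z' hz'
      refine hgoal (θ + (1 - θ) / 4) (by linarith) ?_
      rw [add_mul]
      linarith
    · have hcutN : (2 : ℝ) ^ (N - 1) / (N : ℝ) ^ a < (cutPoints β c).card := lt_of_not_ge hcut
      have hdc : ((cutPoints β c).card : ℝ) ≤ ((N : ℝ) ^ 2 + 1) * (losers β c).card := by
        exact_mod_cast cutPoints_le h3 β c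
      have hsum : (affWinCard β c : ℝ) + (losers β c).card = (2 : ℝ) ^ (N - 1) := by
        exact_mod_cast affWinCard_add_losers (by omega) β c
      have hN2 : (2 : ℝ) ≤ N := by exact_mod_cast (show 2 ≤ N by omega)
      have hcube : (N : ℝ) ^ 2 + 1 ≤ (N : ℝ) ^ 3 := by nlinarith
      have hNa : (0 : ℝ) < (N : ℝ) ^ a := by positivity
      have hlos : (2 : ℝ) ^ (N - 1) / (N : ℝ) ^ (a + 3) ≤ (losers β c).card := by
        have h1 : (2 : ℝ) ^ (N - 1) < (N : ℝ) ^ a * (((N : ℝ) ^ 2 + 1) * (losers β c).card) := by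
          have := (div_lt_iff₀' hNa).1 hcutN
          nlinarith
        have h2 : (N : ℝ) ^ a * (((N : ℝ) ^ 2 + 1) * (losers β c).card) ≤ (N : ℝ) ^ (a + 3) * (losers β c).card := by
          rw [pow_add, mul_assoc]
          refine mul_le_mul_of_nonneg_left (mul_le_mul_of_nonneg_right hcube (by positivity)) hNa.le
        rw [div_le_iff₀' (by positivity)]
        linarith
      have hdiv : (1 - 1 / (N : ℝ) ^ (a + 3)) * (2 : ℝ) ^ (N - 1) = (2 : ℝ) ^ (N - 1) - (2 : ℝ) ^ (N - 1) / (N : ℝ) ^ (a + 3) := by ring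
      rw [hdiv]
      linarith


end AffBells29

end Summit.QuantumAdvantage.AdviceFreeQNC0
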